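import Summits.AnomalousDissipation.AnomalousDissipation.Theorems.SolenoidalFractalHomogenisationLagrangianStepFrameChainRuleAE
import Summits.AnomalousDissipation.AnomalousDissipation.Theorems.SolenoidalFractalHomogenisationLagrangianStepFrameToEulerian
import HarnessLib

/-!
# K1L_D (stmt-AnomalousDissipation-27980), v2 road (memo L22 §4) step (K3b): the chain rule along the FORWARD flow holds for a.e. `(τ, y)` —
# `FrameConj.ae_ae_timeDeriv_comp_backward` (helper, `--supports 27980 --as helper`; prover lead-k1l-onelevel-p1 g7)

Setting of the converse of (C6): closed piece `[w, t]`, `w = jR`, base `σ₁ ≥ 0`, horizon `T = a(t − w) − σ₁`, clock `t′(τ) = w + (σ₁+τ)/a` on `(0,T)`.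
For a family `Φ : ℝ → 𝕋³ → F` that is jointly continuous, has `C¹` slices with `(τ, x) ↦ ∂Φ` jointly continuous, and is time-Lipschitz on `[0, T]`
uniformly in `x` (e.g. the backward reading of an admissible distorted test, `…FrameBackwardLipschitz`), define the forward reading
`Ψ τ y := Φ τ (X m (t′ τ) w y)`.  THEN for a.e. `τ ∈ (0,T)` and a.e. `y`:
`timeDeriv Ψ τ y = timeDeriv Φ τ (X m (t′τ) w y) + (1/a)·((b_{≤m}(t′τ)·∇)(Φ τ))(X m (t′τ) w y)`.
Proof: the non-differentiability set `N = {(τ, x) : ¬ DifferentiableAt (Φ · x) τ}` is measurable (`measurableSet_of_differentiableAt_with_param`) and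
null on `(0,T) × 𝕋³` (Rademacher in one variable, slice by slice); the forward shear `(τ, y) ↦ (τ, X m (t′τ) w y)` preserves `(vol|(0,T)) × vol`
(`measurePreserving_shear_forward`), so a.e. `(τ, y)` lands in the good set; there the deterministic chain rule `hasDerivAt_comp_curve_of_partial`
applies to the lifts (`Fl s v = Φ s (proj v)`, lifted curve `c s = repr y + disp m (t′ s) w y`, `c′ = (1/a) b_{≤m}(t′τ, X y)` by `hasDerivAt_disp_affine`).
No sorry, no definition, no named fact.  NOT a proof of the converse reading lemma, of `stub_Vmod_EHTthg`, of K1L_D or AD; rung F-D1.A0.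
-/

set_option linter.dupNamespace false

noncomputable section

namespace Summit.AnomalousDissipation.AnomalousDissipation.Theorems.SolenoidalFractalHomogenisation.LagrangianStep.FrameConj

open Set Function Filter MeasureTheory Topology
open scoped NNReal ENNReal Topology
open Literature.Analysis Literature.Analysis.FunctionSpaces Literature.Analysis.FunctionSpaces.Torus
open Literature.Analysis.FluidPDE Literature.Analysis.FluidPDE.LatticeShear
open Literature.Analysis.FluidPDE.LatticeShear (LagrangianLatticeCarrier)

variable {k : ℕ}
variable {F : Type*} [NormedAddCommGroup F] [NormedSpace ℝ F] [FiniteDimensional ℝ F]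

/-- **The space–time shear by FORWARD maps preserves `(vol|S) × vol`**: `(τ, y) ↦ (τ, X m (θ τ) s y)` for a continuous clock `θ`. -/
theorem measurePreserving_shear_forward (E : LagrangianLatticeCarrier k) (hR : E.LevelRegular) (m : ℕ) (s : ℝ) {θ : ℝ → ℝ}
    (hθ : Continuous θ) (S : Set ℝ) :
    MeasurePreserving (fun p : ℝ × UnitAddTorus (Fin 3) => (p.1, E.X m (θ p.1) s p.2))
      ((volume.restrict S).prod volume) ((volume.restrict S).prod volume) := by
  have hgm : Measurable (uncurry fun (τ : ℝ) (x : UnitAddTorus (Fin 3)) => E.X m (θ τ) s x) :=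
    ((continuous_X_uncurry E hR m s).comp ((hθ.comp continuous_fst).prodMk continuous_snd)).measurable
  exact (MeasurePreserving.id (volume.restrict S)).skew_product (g := fun τ x => E.X m (θ τ) s x) hgm
    (Filter.Eventually.of_forall fun τ => (hR.measurePreserving_X m (θ τ) s).map_eq)

/-- **(K3b) The chain rule along the forward flow, for a.e. `(τ, y)`.**  See the module docstring. -/
theorem ae_ae_timeDeriv_comp_forward (E : LagrangianLatticeCarrier k) (hR : E.LevelRegular) {m : ℕ} (hF : E.IsFlow m)
    (w σ₁ : ℝ) {T : ℝ} {Φ : ℝ → UnitAddTorus (Fin 3) → F}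
    (hΦc : Continuous (uncurry Φ)) (hΦs : ∀ τ, IsSmooth (Φ τ))
    (hΦd : ∀ i, Continuous (uncurry fun τ x => Torus.partialDeriv i (Φ τ) x))
    (hΦL : ∃ L : ℝ, 0 ≤ L ∧ ∀ τ ∈ Icc 0 T, ∀ s ∈ Icc 0 T, ∀ x, ‖Φ τ x - Φ s x‖ ≤ L * |τ - s|) :
    ∀ᵐ τ ∂(volume.restrict (Ioo 0 T)), ∀ᵐ y ∂(volume : Measure (UnitAddTorus (Fin 3))),
      Torus.timeDeriv (fun s y => Φ s (E.X m (w + (σ₁ + s) / E.a (m + 1)) w y)) τ y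
        = Torus.timeDeriv Φ τ (E.X m (w + (σ₁ + τ) / E.a (m + 1)) w y)
          + (1 / E.a (m + 1)) • Torus.convect (E.partialSum m (w + (σ₁ + τ) / E.a (m + 1))) (Φ τ)
              (E.X m (w + (σ₁ + τ) / E.a (m + 1)) w y) := by
  obtain ⟨L, hL0, hL⟩ := hΦL
  -- the good set `G = {(τ, x) : DifferentiableAt (Φ · x) τ}` is measurable and of full measure on `(0,T) × 𝕋³`
  have hcont' : Continuous (uncurry fun (x : UnitAddTorus (Fin 3)) (τ : ℝ) => Φ τ x) := hΦc.comp continuous_swap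
  have hGm : MeasurableSet {p : UnitAddTorus (Fin 3) × ℝ | DifferentiableAt ℝ (fun τ => Φ τ p.1) p.2} :=
    measurableSet_of_differentiableAt_with_param (𝕜 := ℝ) (f := fun (x : UnitAddTorus (Fin 3)) (τ : ℝ) => Φ τ x) hcont'
  have hx : ∀ x, ∀ᵐ τ ∂(volume.restrict (Ioo 0 T)), DifferentiableAt ℝ (fun s => Φ s x) τ := by
    intro x
    have hlip : LipschitzOnWith (Real.toNNReal L) (fun s => Φ s x) (Icc 0 T) :=
      LipschitzOnWith.of_dist_le' fun a ha b' hb => by rw [dist_eq_norm, Real.dist_eq]; exact hL a ha b' hb x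
    have h1 := hlip.ae_differentiableWithinAt_of_mem (μ := volume)
    filter_upwards [ae_restrict_mem measurableSet_Ioo, ae_restrict_of_ae (s := Ioo 0 T) h1] with τ hτ h1τ
    exact (h1τ (Ioo_subset_Icc_self hτ)).differentiableAt (Icc_mem_nhds hτ.1 hτ.2)
  have hprod : ∀ᵐ z ∂((volume : Measure (UnitAddTorus (Fin 3))).prod (volume.restrict (Ioo 0 T))),
      z ∈ {p : UnitAddTorus (Fin 3) × ℝ | DifferentiableAt ℝ (fun τ => Φ τ p.1) p.2} :=
    (Measure.ae_prod_mem_iff_ae_ae_mem hGm).2 (ae_of_all _ hx)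
  -- swap to `(τ, x)` and pull back by the forward shear
  have hswap : ∀ᵐ z ∂((volume.restrict (Ioo 0 T)).prod (volume : Measure (UnitAddTorus (Fin 3)))),
      DifferentiableAt ℝ (fun s => Φ s z.2) z.1 :=
    (Measure.measurePreserving_swap (μ := volume.restrict (Ioo 0 T))
      (ν := (volume : Measure (UnitAddTorus (Fin 3))))).quasiMeasurePreserving.ae hprod
  have hclock : Continuous fun τ : ℝ => w + (σ₁ + τ) / E.a (m + 1) := by fun_prop
  have hpull := (measurePreserving_shear_forward E hR m w hclock (Ioo 0 T)).quasiMeasurePreserving.ae hswap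
  -- Fubini: a.e. τ, a.e. y
  have hae := Measure.ae_ae_of_ae_prod hpull
  filter_upwards [hae, ae_restrict_mem measurableSet_Ioo] with τ hτ hτI
  filter_upwards [hτ] with y hy
  -- at a good point: the deterministic chain rule on the lifts
  set x : UnitAddTorus (Fin 3) := E.X m (w + (σ₁ + τ) / E.a (m + 1)) w y with hx
  have ha : E.a (m + 1) ≠ 0 := (E.a_pos (m + 1)).ne'
  -- lifted objects
  set Fl : ℝ → EuclideanSpace ℝ (Fin 3) → F := fun s v => Φ s (proj v) with hFl
  set c : ℝ → EuclideanSpace ℝ (Fin 3) := fun s => repr y + E.disp m (w + σ₁ / E.a (m + 1) + 1 / E.a (m + 1) * s) w y with hc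
  have hclk : ∀ s : ℝ, w + σ₁ / E.a (m + 1) + 1 / E.a (m + 1) * s = w + (σ₁ + s) / E.a (m + 1) := fun s => by
    field_simp; ring
  have hcX : ∀ s, proj (c s) = E.X m (w + (σ₁ + s) / E.a (m + 1)) w y := fun s => by
    simp only [hc, proj_add, proj_repr, hclk]
    rw [LagrangianLatticeCarrier.X_apply]
  have hslice : ∀ s, Differentiable ℝ (Fl s) := fun s => ((hΦs s).differentiable (by simp))
  have hcont : ContinuousAt (uncurry fun s v => fderiv ℝ (Fl s) v) (τ, c τ) := by
    -- `fderiv (lift (Φ s)) v = Torus.fderiv (Φ s) (proj v) = Σ_i ⟪·⟫ ∂_i Φ s (proj v)`: jointly continuous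
    have hF : (uncurry fun s v => fderiv ℝ (Fl s) v) = fun p : ℝ × EuclideanSpace ℝ (Fin 3) =>
        ∑ i, (EuclideanSpace.proj i : EuclideanSpace ℝ (Fin 3) →L[ℝ] ℝ).smulRight (Torus.partialDeriv i (Φ p.1) (proj p.2)) := by
      funext p
      simp only [uncurry, hFl]
      rw [show (fun v => Φ p.1 (proj v)) = lift (Φ p.1) from rfl, fderiv_lift]
      ext v
      rw [fderiv_apply_eq_sum_partialDeriv ((hΦs p.1).isContDiff (by simp)), FunLike.coe_sum, Finset.sum_apply]
      refine Finset.sum_congr rfl fun i _ => ?_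
      rw [ContinuousLinearMap.smulRight_apply]; rfl
    rw [hF]
    refine (continuous_finsetSum _ fun i _ => ?_).continuousAt
    refine (ContinuousLinearMap.smulRightL ℝ _ _ (EuclideanSpace.proj i : EuclideanSpace ℝ (Fin 3) →L[ℝ] ℝ)).continuous.comp ?_
    exact (hΦd i).comp (continuous_fst.prodMk (continuous_proj.comp continuous_snd))
  have hc' : HasDerivAt c ((1 / E.a (m + 1)) • E.partialSum m (w + (σ₁ + τ) / E.a (m + 1)) x) τ := by
    have h := hasDerivAt_disp_affine E hR hF w (w + σ₁ / E.a (m + 1)) (1 / E.a (m + 1)) τ y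
    rw [hclk τ] at h
    exact h.const_add (repr y)
  have hD₁ : HasDerivAt (fun s => Fl s (c τ)) (Torus.timeDeriv Φ τ x) τ := by
    have hpt : proj (c τ) = x := hcX τ
    simp only [hFl, hpt]
    exact hy.hasDerivAt
  have key := hasDerivAt_comp_curve_of_partial hslice hcont hc' hD₁
  -- read back on the torus
  have hfun : (fun s => Fl s (c s)) = fun s => Φ s (E.X m (w + (σ₁ + s) / E.a (m + 1)) w y) := by
    funext s; simp only [hFl, hcX]
  rw [hfun] at key
  have hder : fderiv ℝ (Fl τ) (c τ) = Torus.fderiv (Φ τ) x := by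
    rw [show Fl τ = lift (Φ τ) from rfl, fderiv_lift, hcX]
  rw [hder, map_smul] at key
  unfold Torus.timeDeriv
  rw [key.deriv]
  rfl

end Summit.AnomalousDissipation.AnomalousDissipation.Theorems.SolenoidalFractalHomogenisation.LagrangianStep.FrameConj

end
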